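/-
Copyright (c) 2026 the pub-hodgecm-mathlib formalisation cell (harness21).  Prover seat hodgecm-mathlib-R90-CS-p03 (g2), R90-TF section S8 «ContSpec-n½» (dealer R90-CS-plan (g3),
S8-R151 (2) J-S8-∞ «CS-p03 — type (4b) … |m| ≤ 2 first and name the non-vanishing condition at 3∕2: m_w ∉ ±(2ℕ+3)»; file (a-6), brick (4b)-core): the ONE-VARIABLE archimedean
Beta-type integrals of the χ-intertwining amplitude at the middle point `z = 3∕2` DO NOT VANISH for `S¹`-weights `|m| ≤ 2` — elementary real analysis, no Γ-function.
-/
import Summits.HodgeConjecture.HodgeConjecture.Theorems.K2E1IntertwiningArchFactorIntegrableU3   -- ★ `integrable_and_integral_add_mul_sq_rpow_neg` (`(B + c a²)^{−σ} ∈ L¹(ℝ)`, `σ > ½`)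
import Mathlib.MeasureTheory.Integral.IntegralEqImproper
import HarnessLib

/-!
# K2·E1 ∕ R90·S8 — `K2E1ChiArchBetaNonvanishingU3` (file (a-6), brick (4b)-core): THE ARCHIMEDEAN `s`-INTEGRALS OF THE χ-INTERTWINING AMPLITUDE AT `z = 3∕2` DO NOT VANISH FOR
# `S¹`-WEIGHTS `m ∈ {0, ±1, ±2}` — `∫_ℝ (A + iBs)^m (A² + B²s²)^{−(3+m)∕2} ds ≠ 0` (`A > 0`, `B ≠ 0`)

Cell `pub/hodgecm-mathlib`, crux h413 = `stmt-HodgeConjecture-24833`, route of record `HCCMUnconditional`; R90-TF section S8 «ContSpec-n½», road R2-χ₃ (the (V) scalar road; ★ F5's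
binder `hA32 : A (3∕2) ≠ 0`, archimedean half; junction J-S8-∞ with K2E1-p11's section witness `R90S8ChiSectionPairNonzeroWitnessU3`).  THEOREMS ONLY (no `def`, no `instance`, no
notation, no named-fact hypothesis, no `sorry`; default heartbeats); lane `--supports stmt-HodgeConjecture-24833 --as helper` (count-neutral).  Closes no socket.

THE MATHEMATICS ([MoeglinWaldspurger1995] IV.1.11; [Langlands1976] Appendix; [Titchmarsh1939] §1.8).  At a complex place `w` of `L`, on the big cell `ι(w₀)u(X_w, θ s_w)` write
`Z_w = A_w + i B_w s_w` with `A_w = 1 + ‖X_w‖²∕2 > 0`, `B_w = wδ ≠ 0`, so that ★ (a2)₃'s archimedean height factor is `ARCH_w = |Z_w|² = A_w² + B_w² s_w²`; an archimedean section of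
`S¹`-weight `m` on the torus phase contributes the weight `(Z_w∕|Z_w|)^m`, and at `z = 3∕2` the `s_w`-integrand is `(Z∕|Z|)^m·|Z|^{−2z} = (A + iBs)^m (A² + B²s²)^{−(3+m)∕2}`.  CAUCHY's beta
integral gives `∫_ℝ (A+iBs)^m (A²+B²s²)^{−z−m∕2} ds = (A^{1−2z}∕|B|)·π·Γ(2z−1)∕(2^{2z−2}Γ(z+m∕2)Γ(z−m∕2))`, which at `z = 3∕2` vanishes EXACTLY for `m ∈ ±{3,5,7,…}` (pole of `Γ(3∕2 − |m|∕2)`).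
Cauchy's integral is not in Mathlib; THIS FILE proves the non-vanishing for `|m| ≤ 2` ELEMENTARILY: `m = 0` positivity; `m = ±1`: `Re ∫ = A·∫(A²+B²s²)^{−2} > 0`; `m = ±2`:
`Re ∫ = ∫ (A² − B²s²)(A²+B²s²)^{−5∕2} ds = B²·∫ s²(A²+B²s²)^{−5∕2} ds > 0` by the fundamental theorem of calculus on `g(s) = s·(A²+B²s²)^{−3∕2}` (`g, g′ ∈ L¹`, so `∫ g′ = 0`, Mathlib
`integral_eq_zero_of_hasDerivAt_of_integrable`), the imaginary parts being irrelevant.  (Check: `m = 3` gives `∫ (1−3t²)(1+t²)^{−3} dt = 0` — the Γ-pole.)  The sign of `m` is the sign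
of `B`, so the `−m` cases are the `+m` cases at `−B`.
* §0 `integrable_base_rpow_neg`, `integral_base_rpow_neg_pos` (★ engine + positivity), `sq_mul_base_rpow_le`, `integrable_sq_mul_base_rpow_neg_fiveHalves`, `integral_sq_mul_base_rpow_neg_fiveHalves_pos`.
* §1 **`integral_base_rpow_neg_threeHalves_pos`** (`m = 0`).  §2 **`integral_phaseOne_mul_base_rpow_neg_two_ne_zero`** (`m = ±1`, any `B ≠ 0`).
* §3 `hasDerivAt_mul_base_rpow_neg_threeHalves`, `integral_deriv_mul_base_rpow_eq_zero`, **`integral_phaseTwo_mul_base_rpow_neg_fiveHalves_ne_zero`** (`m = ±2`, any `B ≠ 0`).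
HONEST SCOPE.  NOT here: the uniform Γ-form (Cauchy's beta integral, L), the `X_w`-integral and the product over places ∕ the `∫_{L_∞}∫_{L⁺_∞}` assembly of ★ (a-3)'s archimedean factor (waits
for K2E1-p11's FILE 3 bytes of the section weight in `(A_w, B_w s_w, X_w)` coordinates), `|m| ≥ 4` even (non-zero by the Γ-form, not proved here).
HONEST LABEL: HC_CM is proved only modulo the 7 printed citations (2 remaining named inputs: hLiu418 = `stmt-HodgeConjecture-24832`, h413 = `stmt-HodgeConjecture-24833`) until rung 0
closes; REL ≠ ★ ≠ BUILT; this file asserts no named fact and closes no socket; count-neutral; unconditional real analysis.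

## References
* [MoeglinWaldspurger1995] C. Mœglin, J.-L. Waldspurger, *Spectral Decomposition and Eisenstein Series* (1995): IV.1.11.
* [Langlands1976] R. P. Langlands, *On the Functional Equations Satisfied by Eisenstein Series*, LNM 544 (1976): Appendix (rank one).
* [Titchmarsh1939] E. C. Titchmarsh, *The Theory of Functions*, 2nd ed. (1939): §1.8.
-/

set_option autoImplicit false
set_option linter.dupNamespace false -- the mandated namespace repeats `HodgeConjecture.HodgeConjecture`

noncomputable section

open MeasureTheory Filter Set
open scoped Topology
open Summit.HodgeConjecture.HodgeConjecture.Cruxes.H413.K2E1IntertwiningArchFactorIntegrableU3 (integrable_and_integral_add_mul_sq_rpow_neg)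

namespace Summit.HodgeConjecture.HodgeConjecture.Cruxes.H413.K2E1ChiArchBetaNonvanishingU3

variable {A B : ℝ}

/-! ## §0 The base `A² + B²s²`: positivity, integrability of its negative powers, the `s²`-moment -/

/-- `A² + B²s² > 0` for `A > 0`. [folklore] -/
theorem base_pos (hA : 0 < A) (B s : ℝ) : 0 < A ^ 2 + B ^ 2 * s ^ 2 := by positivity

/-- `(A² + B²s²)^{−a} ∈ L¹(ℝ)` for `a > ½` (`B ≠ 0`; ★ `integrable_and_integral_add_mul_sq_rpow_neg`). [cite: Titchmarsh1939, §1.8] -/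
theorem integrable_base_rpow_neg (hA : 0 < A) (hB : B ≠ 0) {a : ℝ} (ha : 1 / 2 < a) :
    Integrable (fun s : ℝ => (A ^ 2 + B ^ 2 * s ^ 2) ^ (-a)) :=
  (integrable_and_integral_add_mul_sq_rpow_neg (pow_pos hA 2) (by positivity) ha).1

/-- `0 < ∫ (A² + B²s²)^{−a} ds` for `a > ½` (positive integrand, integrable). [cite: Titchmarsh1939, §1.8] -/
theorem integral_base_rpow_neg_pos (hA : 0 < A) (hB : B ≠ 0) {a : ℝ} (ha : 1 / 2 < a) :
    0 < ∫ s : ℝ, (A ^ 2 + B ^ 2 * s ^ 2) ^ (-a) := by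
  rw [integral_pos_iff_support_of_nonneg (fun s => (Real.rpow_pos_of_pos (base_pos hA B s) _).le) (integrable_base_rpow_neg hA hB ha)]
  have hsupp : Function.support (fun s : ℝ => (A ^ 2 + B ^ 2 * s ^ 2) ^ (-a)) = univ :=
    eq_univ_of_forall fun s => Function.mem_support.2 (Real.rpow_pos_of_pos (base_pos hA B s) _).ne'
  rw [hsupp]
  exact isOpen_univ.measure_pos volume univ_nonempty

/-- `s²·(A² + B²s²)^{−a} ≤ B⁻²·(A² + B²s²)^{1−a}` (`B²s² ≤ A² + B²s²`). [folklore] -/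
theorem sq_mul_base_rpow_le (hA : 0 < A) (hB : B ≠ 0) (a s : ℝ) :
    s ^ 2 * (A ^ 2 + B ^ 2 * s ^ 2) ^ (-a) ≤ (B ^ 2)⁻¹ * (A ^ 2 + B ^ 2 * s ^ 2) ^ (1 - a) := by
  have hx := base_pos hA B s
  have hB2 : 0 < B ^ 2 := by positivity
  rw [sub_eq_add_neg, Real.rpow_add hx, Real.rpow_one, ← mul_assoc]
  refine mul_le_mul_of_nonneg_right ?_ (Real.rpow_nonneg hx.le _)
  rw [le_inv_mul_iff₀ hB2]
  nlinarith [sq_nonneg A]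

/-- `s²·(A² + B²s²)^{−5∕2} ∈ L¹(ℝ)` (dominated by `B⁻²(A²+B²s²)^{−3∕2}`). [cite: Titchmarsh1939, §1.8] -/
theorem integrable_sq_mul_base_rpow_neg_fiveHalves (hA : 0 < A) (hB : B ≠ 0) :
    Integrable (fun s : ℝ => s ^ 2 * (A ^ 2 + B ^ 2 * s ^ 2) ^ (-(5 / 2 : ℝ))) := by
  have hc : Continuous fun s : ℝ => s ^ 2 * (A ^ 2 + B ^ 2 * s ^ 2) ^ (-(5 / 2 : ℝ)) :=
    (continuous_id.pow 2).mul ((continuous_const.add (continuous_const.mul (continuous_id.pow 2))).rpow_const fun s => Or.inl (base_pos hA B s).ne')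
  refine ((integrable_base_rpow_neg hA hB (a := 3 / 2) (by norm_num)).const_mul (B ^ 2)⁻¹).mono' hc.aestronglyMeasurable (Eventually.of_forall fun s => ?_)
  rw [Real.norm_of_nonneg (mul_nonneg (sq_nonneg s) (Real.rpow_nonneg (base_pos hA B s).le _))]
  have h := sq_mul_base_rpow_le hA hB (5 / 2) s
  norm_num at h ⊢
  exact h

/-- `0 < ∫ s²·(A² + B²s²)^{−5∕2} ds` (non-negative integrand, positive off `s = 0`). [cite: Titchmarsh1939, §1.8] -/
theorem integral_sq_mul_base_rpow_neg_fiveHalves_pos (hA : 0 < A) (hB : B ≠ 0) :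
    0 < ∫ s : ℝ, s ^ 2 * (A ^ 2 + B ^ 2 * s ^ 2) ^ (-(5 / 2 : ℝ)) := by
  rw [integral_pos_iff_support_of_nonneg (fun s => mul_nonneg (sq_nonneg s) (Real.rpow_nonneg (base_pos hA B s).le _))
    (integrable_sq_mul_base_rpow_neg_fiveHalves hA hB)]
  refine lt_of_lt_of_le (by rw [Real.volume_Ioi]; exact ENNReal.zero_lt_top) (measure_mono fun s (hs : s ∈ Ioi (0 : ℝ)) => ?_)
  exact Function.mem_support.2 (mul_ne_zero (pow_ne_zero 2 (ne_of_gt hs)) (Real.rpow_pos_of_pos (base_pos hA B s) _).ne')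

/-! ## §1 `m = 0`: positivity at `z = 3∕2` -/

/-- **`m = 0`**: `0 < ∫ (A² + B²s²)^{−3∕2} ds`. [cite: MoeglinWaldspurger1995, IV.1.11] -/
theorem integral_base_rpow_neg_threeHalves_pos (hA : 0 < A) (hB : B ≠ 0) :
    0 < ∫ s : ℝ, (A ^ 2 + B ^ 2 * s ^ 2) ^ (-(3 / 2 : ℝ)) :=
  integral_base_rpow_neg_pos hA hB (by norm_num)

/-! ## §2 `m = ±1`: the real part is `A·∫(A² + B²s²)^{−2} > 0` -/

/-- **`m = ±1`** (the sign of `m` is the sign of `B`): `∫ (A + iBs)·(A² + B²s²)^{−2} ds ≠ 0` — its real part is `A·∫(A²+B²s²)^{−2} ds > 0`. [cite: MoeglinWaldspurger1995, IV.1.11]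
[cite: Langlands1976, Appendix] -/
theorem integral_phaseOne_mul_base_rpow_neg_two_ne_zero (hA : 0 < A) (hB : B ≠ 0) :
    ∫ s : ℝ, ((A : ℂ) + ((B * s : ℝ) : ℂ) * Complex.I) * (((A ^ 2 + B ^ 2 * s ^ 2) ^ (-(2 : ℝ)) : ℝ) : ℂ) ≠ 0 := by
  have hbase : Continuous fun s : ℝ => A ^ 2 + B ^ 2 * s ^ 2 := continuous_const.add (continuous_const.mul (continuous_id.pow 2))
  have hcρ : Continuous fun s : ℝ => (A ^ 2 + B ^ 2 * s ^ 2) ^ (-(2 : ℝ)) := hbase.rpow_const fun s => Or.inl (base_pos hA B s).ne'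
  have hcF : Continuous fun s : ℝ => ((A : ℂ) + ((B * s : ℝ) : ℂ) * Complex.I) * (((A ^ 2 + B ^ 2 * s ^ 2) ^ (-(2 : ℝ)) : ℝ) : ℂ) :=
    (continuous_const.add ((Complex.continuous_ofReal.comp (continuous_const.mul continuous_id)).mul continuous_const)).mul (Complex.continuous_ofReal.comp hcρ)
  have hFint : Integrable fun s : ℝ => ((A : ℂ) + ((B * s : ℝ) : ℂ) * Complex.I) * (((A ^ 2 + B ^ 2 * s ^ 2) ^ (-(2 : ℝ)) : ℝ) : ℂ) := by
    refine (integrable_base_rpow_neg hA hB (a := 3 / 2) (by norm_num)).mono' hcF.aestronglyMeasurable (Eventually.of_forall fun s => le_of_eq ?_)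
    rw [norm_mul, Complex.norm_add_mul_I, Complex.norm_real, Real.norm_of_nonneg (Real.rpow_nonneg (base_pos hA B s).le _), Real.sqrt_eq_rpow, mul_pow,
      ← Real.rpow_add (base_pos hA B s)]
    norm_num
  have hre : (∫ s : ℝ, ((A : ℂ) + ((B * s : ℝ) : ℂ) * Complex.I) * (((A ^ 2 + B ^ 2 * s ^ 2) ^ (-(2 : ℝ)) : ℝ) : ℂ)).re = ∫ s : ℝ, A * (A ^ 2 + B ^ 2 * s ^ 2) ^ (-(2 : ℝ)) := by
    have h := integral_re hFint
    simp only [RCLike.re_to_complex] at h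
    rw [← h]
    refine integral_congr_ae (Eventually.of_forall fun s => ?_)
    simp only [Complex.mul_re, Complex.add_re, Complex.ofReal_re, Complex.mul_im, Complex.add_im, Complex.ofReal_im, Complex.I_re, Complex.I_im]
    ring
  have hpos : 0 < ∫ s : ℝ, A * (A ^ 2 + B ^ 2 * s ^ 2) ^ (-(2 : ℝ)) := by
    rw [integral_const_mul]
    exact mul_pos hA (integral_base_rpow_neg_pos hA hB (by norm_num))
  intro h0
  rw [h0, Complex.zero_re] at hre
  linarith

/-! ## §3 `m = ±2`: `∫ (A² − B²s²)(A² + B²s²)^{−5∕2} ds = B²·∫ s²(A² + B²s²)^{−5∕2} ds > 0` by the fundamental theorem of calculus -/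

/-- `g(s) = s·(A²+B²s²)^{−3∕2}` has derivative `(A²+B²s²)^{−3∕2} + s·((B²·(2s))·(−3∕2)·(A²+B²s²)^{−3∕2−1})` (product and chain rules). [folklore] -/
theorem hasDerivAt_mul_base_rpow_neg_threeHalves (hA : 0 < A) (B s : ℝ) :
    HasDerivAt (fun s : ℝ => s * (A ^ 2 + B ^ 2 * s ^ 2) ^ (-(3 / 2 : ℝ)))
      (1 * (A ^ 2 + B ^ 2 * s ^ 2) ^ (-(3 / 2 : ℝ)) + s * (B ^ 2 * (↑(2 : ℕ) * s ^ (2 - 1)) * (-(3 / 2 : ℝ)) * (A ^ 2 + B ^ 2 * s ^ 2) ^ (-(3 / 2 : ℝ) - 1))) s := by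
  have hx : HasDerivAt (fun s : ℝ => A ^ 2 + B ^ 2 * s ^ 2) (B ^ 2 * (↑(2 : ℕ) * s ^ (2 - 1))) s :=
    ((hasDerivAt_pow 2 s).const_mul (B ^ 2)).const_add (A ^ 2)
  have hρ : HasDerivAt (fun s : ℝ => (A ^ 2 + B ^ 2 * s ^ 2) ^ (-(3 / 2 : ℝ)))
      (B ^ 2 * (↑(2 : ℕ) * s ^ (2 - 1)) * (-(3 / 2 : ℝ)) * (A ^ 2 + B ^ 2 * s ^ 2) ^ (-(3 / 2 : ℝ) - 1)) s :=
    hx.rpow_const (Or.inl (base_pos hA B s).ne')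
  exact (hasDerivAt_id' s).mul hρ

/-- The raw derivative of `g` rewritten: `g′(s) + B²s²(A²+B²s²)^{−5∕2} = (A² − B²s²)(A²+B²s²)^{−5∕2}`. [folklore] -/
theorem deriv_identity (hA : 0 < A) (B s : ℝ) :
    1 * (A ^ 2 + B ^ 2 * s ^ 2) ^ (-(3 / 2 : ℝ)) + s * (B ^ 2 * (↑(2 : ℕ) * s ^ (2 - 1)) * (-(3 / 2 : ℝ)) * (A ^ 2 + B ^ 2 * s ^ 2) ^ (-(3 / 2 : ℝ) - 1)) +
        B ^ 2 * (s ^ 2 * (A ^ 2 + B ^ 2 * s ^ 2) ^ (-(5 / 2 : ℝ))) =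
      (A ^ 2 - B ^ 2 * s ^ 2) * (A ^ 2 + B ^ 2 * s ^ 2) ^ (-(5 / 2 : ℝ)) := by
  have hx := base_pos hA B s
  have h1 : (A ^ 2 + B ^ 2 * s ^ 2) ^ (-(3 / 2 : ℝ)) = (A ^ 2 + B ^ 2 * s ^ 2) * (A ^ 2 + B ^ 2 * s ^ 2) ^ (-(5 / 2 : ℝ)) := by
    rw [show (-(3 / 2 : ℝ)) = 1 + -(5 / 2 : ℝ) by norm_num, Real.rpow_add hx, Real.rpow_one]
  have h2 : (A ^ 2 + B ^ 2 * s ^ 2) ^ (-(3 / 2 : ℝ) - 1) = (A ^ 2 + B ^ 2 * s ^ 2) ^ (-(5 / 2 : ℝ)) := by norm_num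
  rw [h1, h2]
  push_cast
  ring

/-- `g(s) = s·(A²+B²s²)^{−3∕2} ∈ L¹(ℝ)` (`|s|(A²+B²s²)^{−3∕2} ≤ |B|⁻¹(A²+B²s²)^{−1}`). [folklore] -/
theorem integrable_mul_base_rpow_neg_threeHalves (hA : 0 < A) (hB : B ≠ 0) :
    Integrable (fun s : ℝ => s * (A ^ 2 + B ^ 2 * s ^ 2) ^ (-(3 / 2 : ℝ))) := by
  have hc : Continuous fun s : ℝ => s * (A ^ 2 + B ^ 2 * s ^ 2) ^ (-(3 / 2 : ℝ)) :=
    continuous_id.mul ((continuous_const.add (continuous_const.mul (continuous_id.pow 2))).rpow_const fun s => Or.inl (base_pos hA B s).ne')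
  refine ((integrable_base_rpow_neg hA hB (a := 1) (by norm_num)).const_mul |B|⁻¹).mono' hc.aestronglyMeasurable (Eventually.of_forall fun s => ?_)
  have hx := base_pos hA B s
  have hBpos : 0 < |B| := abs_pos.2 hB
  rw [norm_mul, Real.norm_eq_abs, Real.norm_of_nonneg (Real.rpow_nonneg hx.le _)]
  -- `|s|·x^{−3/2} = (|B s|·x^{−1/2})·|B|⁻¹·x^{−1}` and `|B s| ≤ x^{1/2}`
  have hsq : |B * s| ≤ (A ^ 2 + B ^ 2 * s ^ 2) ^ (1 / 2 : ℝ) := by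
    rw [← Real.sqrt_eq_rpow]
    refine Real.abs_le_sqrt ?_
    nlinarith [sq_nonneg A]
  have hkey : |B * s| * (A ^ 2 + B ^ 2 * s ^ 2) ^ (-(1 / 2 : ℝ)) ≤ 1 := by
    rw [Real.rpow_neg hx.le, ← div_eq_mul_inv, div_le_one (Real.rpow_pos_of_pos hx _)]
    exact hsq
  calc |s| * (A ^ 2 + B ^ 2 * s ^ 2) ^ (-(3 / 2 : ℝ))
      = (|B * s| * (A ^ 2 + B ^ 2 * s ^ 2) ^ (-(1 / 2 : ℝ))) * (|B|⁻¹ * (A ^ 2 + B ^ 2 * s ^ 2) ^ (-(1 : ℝ))) := by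
        rw [abs_mul, show (-(3 / 2 : ℝ)) = -(1 / 2 : ℝ) + -(1 : ℝ) by norm_num, Real.rpow_add hx]
        field_simp
    _ ≤ 1 * (|B|⁻¹ * (A ^ 2 + B ^ 2 * s ^ 2) ^ (-(1 : ℝ))) :=
        mul_le_mul_of_nonneg_right hkey (mul_nonneg (inv_nonneg.2 hBpos.le) (Real.rpow_nonneg hx.le _))
    _ = |B|⁻¹ * (A ^ 2 + B ^ 2 * s ^ 2) ^ (-(1 : ℝ)) := one_mul _

/-- `∫ g′ = 0` for `g(s) = s·(A²+B²s²)^{−3∕2}` (`g, g′ ∈ L¹(ℝ)`; Mathlib `integral_eq_zero_of_hasDerivAt_of_integrable`). [cite: Titchmarsh1939, §1.8] -/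
theorem integral_deriv_mul_base_rpow_eq_zero (hA : 0 < A) (hB : B ≠ 0) :
    ∫ s : ℝ, (1 * (A ^ 2 + B ^ 2 * s ^ 2) ^ (-(3 / 2 : ℝ)) + s * (B ^ 2 * (↑(2 : ℕ) * s ^ (2 - 1)) * (-(3 / 2 : ℝ)) * (A ^ 2 + B ^ 2 * s ^ 2) ^ (-(3 / 2 : ℝ) - 1))) = 0 := by
  refine integral_eq_zero_of_hasDerivAt_of_integrable (hasDerivAt_mul_base_rpow_neg_threeHalves hA B) ?_ (integrable_mul_base_rpow_neg_threeHalves hA hB)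
  -- `g′ = (A² − B²s²)x^{−5/2} − B²s²x^{−5/2}`, both integrable
  have hid : (fun s : ℝ => 1 * (A ^ 2 + B ^ 2 * s ^ 2) ^ (-(3 / 2 : ℝ)) + s * (B ^ 2 * (↑(2 : ℕ) * s ^ (2 - 1)) * (-(3 / 2 : ℝ)) * (A ^ 2 + B ^ 2 * s ^ 2) ^ (-(3 / 2 : ℝ) - 1))) =
      fun s : ℝ => (A ^ 2 * (A ^ 2 + B ^ 2 * s ^ 2) ^ (-(5 / 2 : ℝ)) - B ^ 2 * (s ^ 2 * (A ^ 2 + B ^ 2 * s ^ 2) ^ (-(5 / 2 : ℝ)))) -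
        B ^ 2 * (s ^ 2 * (A ^ 2 + B ^ 2 * s ^ 2) ^ (-(5 / 2 : ℝ))) := by
    funext s
    have h := deriv_identity hA B s
    linear_combination h
  rw [hid]
  exact (((integrable_base_rpow_neg hA hB (a := 5 / 2) (by norm_num)).const_mul (A ^ 2)).sub
    ((integrable_sq_mul_base_rpow_neg_fiveHalves hA hB).const_mul (B ^ 2))).sub ((integrable_sq_mul_base_rpow_neg_fiveHalves hA hB).const_mul (B ^ 2))

/-- **`∫ (A² − B²s²)(A² + B²s²)^{−5∕2} ds = B²·∫ s²(A² + B²s²)^{−5∕2} ds`** (integration by parts through §3's `g`). [cite: Titchmarsh1939, §1.8] -/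
theorem integral_re_phaseTwo_eq (hA : 0 < A) (hB : B ≠ 0) :
    ∫ s : ℝ, (A ^ 2 - B ^ 2 * s ^ 2) * (A ^ 2 + B ^ 2 * s ^ 2) ^ (-(5 / 2 : ℝ)) = B ^ 2 * ∫ s : ℝ, s ^ 2 * (A ^ 2 + B ^ 2 * s ^ 2) ^ (-(5 / 2 : ℝ)) := by
  have hpt : ∀ s : ℝ, (A ^ 2 - B ^ 2 * s ^ 2) * (A ^ 2 + B ^ 2 * s ^ 2) ^ (-(5 / 2 : ℝ)) =
      (1 * (A ^ 2 + B ^ 2 * s ^ 2) ^ (-(3 / 2 : ℝ)) + s * (B ^ 2 * (↑(2 : ℕ) * s ^ (2 - 1)) * (-(3 / 2 : ℝ)) * (A ^ 2 + B ^ 2 * s ^ 2) ^ (-(3 / 2 : ℝ) - 1))) +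
        B ^ 2 * (s ^ 2 * (A ^ 2 + B ^ 2 * s ^ 2) ^ (-(5 / 2 : ℝ))) := fun s => (deriv_identity hA B s).symm
  simp_rw [hpt]
  have hg' : Integrable (fun s : ℝ => 1 * (A ^ 2 + B ^ 2 * s ^ 2) ^ (-(3 / 2 : ℝ)) + s * (B ^ 2 * (↑(2 : ℕ) * s ^ (2 - 1)) * (-(3 / 2 : ℝ)) * (A ^ 2 + B ^ 2 * s ^ 2) ^ (-(3 / 2 : ℝ) - 1))) := by
    have hid : (fun s : ℝ => 1 * (A ^ 2 + B ^ 2 * s ^ 2) ^ (-(3 / 2 : ℝ)) + s * (B ^ 2 * (↑(2 : ℕ) * s ^ (2 - 1)) * (-(3 / 2 : ℝ)) * (A ^ 2 + B ^ 2 * s ^ 2) ^ (-(3 / 2 : ℝ) - 1))) =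
        fun s : ℝ => (A ^ 2 * (A ^ 2 + B ^ 2 * s ^ 2) ^ (-(5 / 2 : ℝ)) - B ^ 2 * (s ^ 2 * (A ^ 2 + B ^ 2 * s ^ 2) ^ (-(5 / 2 : ℝ)))) -
          B ^ 2 * (s ^ 2 * (A ^ 2 + B ^ 2 * s ^ 2) ^ (-(5 / 2 : ℝ))) := by
      funext s
      have h := deriv_identity hA B s
      linear_combination h
    rw [hid]
    exact (((integrable_base_rpow_neg hA hB (a := 5 / 2) (by norm_num)).const_mul (A ^ 2)).sub
      ((integrable_sq_mul_base_rpow_neg_fiveHalves hA hB).const_mul (B ^ 2))).sub ((integrable_sq_mul_base_rpow_neg_fiveHalves hA hB).const_mul (B ^ 2))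
  rw [integral_add hg' ((integrable_sq_mul_base_rpow_neg_fiveHalves hA hB).const_mul (B ^ 2)), integral_deriv_mul_base_rpow_eq_zero hA hB, zero_add,
    integral_const_mul]

/-- **`m = ±2`** (the sign of `m` is the sign of `B`): `∫ (A + iBs)²·(A² + B²s²)^{−5∕2} ds ≠ 0` — its real part is `B²·∫ s²(A²+B²s²)^{−5∕2} ds > 0`.
[cite: MoeglinWaldspurger1995, IV.1.11] [cite: Langlands1976, Appendix] -/
theorem integral_phaseTwo_mul_base_rpow_neg_fiveHalves_ne_zero (hA : 0 < A) (hB : B ≠ 0) :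
    ∫ s : ℝ, ((A : ℂ) + ((B * s : ℝ) : ℂ) * Complex.I) ^ 2 * (((A ^ 2 + B ^ 2 * s ^ 2) ^ (-(5 / 2 : ℝ)) : ℝ) : ℂ) ≠ 0 := by
  have hbase : Continuous fun s : ℝ => A ^ 2 + B ^ 2 * s ^ 2 := continuous_const.add (continuous_const.mul (continuous_id.pow 2))
  have hcρ : Continuous fun s : ℝ => (A ^ 2 + B ^ 2 * s ^ 2) ^ (-(5 / 2 : ℝ)) := hbase.rpow_const fun s => Or.inl (base_pos hA B s).ne'
  have hcF : Continuous fun s : ℝ => ((A : ℂ) + ((B * s : ℝ) : ℂ) * Complex.I) ^ 2 * (((A ^ 2 + B ^ 2 * s ^ 2) ^ (-(5 / 2 : ℝ)) : ℝ) : ℂ) :=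
    ((continuous_const.add ((Complex.continuous_ofReal.comp (continuous_const.mul continuous_id)).mul continuous_const)).pow 2).mul (Complex.continuous_ofReal.comp hcρ)
  have hFint : Integrable fun s : ℝ => ((A : ℂ) + ((B * s : ℝ) : ℂ) * Complex.I) ^ 2 * (((A ^ 2 + B ^ 2 * s ^ 2) ^ (-(5 / 2 : ℝ)) : ℝ) : ℂ) := by
    refine (integrable_base_rpow_neg hA hB (a := 3 / 2) (by norm_num)).mono' hcF.aestronglyMeasurable (Eventually.of_forall fun s => le_of_eq ?_)
    rw [norm_mul, norm_pow, Complex.norm_add_mul_I, Complex.norm_real, Real.norm_of_nonneg (Real.rpow_nonneg (base_pos hA B s).le _), Real.sq_sqrt (by positivity), mul_pow,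
      show (-(3 / 2 : ℝ)) = 1 + -(5 / 2 : ℝ) by norm_num, Real.rpow_add (base_pos hA B s), Real.rpow_one]
  have hre : (∫ s : ℝ, ((A : ℂ) + ((B * s : ℝ) : ℂ) * Complex.I) ^ 2 * (((A ^ 2 + B ^ 2 * s ^ 2) ^ (-(5 / 2 : ℝ)) : ℝ) : ℂ)).re =
      ∫ s : ℝ, (A ^ 2 - B ^ 2 * s ^ 2) * (A ^ 2 + B ^ 2 * s ^ 2) ^ (-(5 / 2 : ℝ)) := by
    have h := integral_re hFint
    simp only [RCLike.re_to_complex] at h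
    rw [← h]
    refine integral_congr_ae (Eventually.of_forall fun s => ?_)
    simp only [pow_two, Complex.mul_re, Complex.add_re, Complex.ofReal_re, Complex.mul_im, Complex.add_im, Complex.ofReal_im, Complex.I_re, Complex.I_im]
    ring
  have hpos : 0 < ∫ s : ℝ, (A ^ 2 - B ^ 2 * s ^ 2) * (A ^ 2 + B ^ 2 * s ^ 2) ^ (-(5 / 2 : ℝ)) := by
    rw [integral_re_phaseTwo_eq hA hB]
    exact mul_pos (by positivity) (integral_sq_mul_base_rpow_neg_fiveHalves_pos hA hB)
  intro h0
  rw [h0, Complex.zero_re] at hre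
  linarith

end Summit.HodgeConjecture.HodgeConjecture.Cruxes.H413.K2E1ChiArchBetaNonvanishingU3

end
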